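import Literature.Probability.Percolation.SepFourAdj
import Literature.Probability.Percolation.NearCriticalFourArmQuasiMult
import HarnessLib

/-!
# The gluing and extension inequalities for well-separated ADJACENT four arms, at every density (proofs only)

Topic `Literature/Probability/Percolation`; family `crit-perc`. PROOFS ONLY (no definition, no
named fact). Serves the named fact `Literature.Probability.Percolation.Werner2009_lemma63`
(Werner 2009, Lecture 6, Lemma 6.3 for the tree's ORDER-FREE `π̂_t`) through Nolin's Thm. 27 for
the adjacent arrangement: the host-quasi-multiplicativity and host-extension inputs of the
pivotal sum for the arc-landed host `arcFourArm 0 3` are obtained from a near-critical adjacent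
separation hypothesis by Kesten's gluing, whose probabilistic half (P. Nolin, EJP 13 (2008), §4.3
Prop. 12 with Lemma 13 [arXiv 0711.4948: Prop. 11, Lemma 12]: generalised FKG for an increasing and
a decreasing event supported on three disjoint regions, independence of the frames, RSW-type
lower bounds for the gluing boxes supplied by the caller) is recorded here for the adjacent fenced
event `sepFourAdj` (`SepFourAdj.lean`), at EVERY density `t` (the closed gluing costs `P_{1-t}`):

* `sepFourAdj_mul_sepFourAdj_mul_glue_le_arc_at` —
  `P_t(sepFourAdj n₁ (64q)) · P_t(sepFourAdj (512Q) n₃) · P_t(G)² · P_{1-t}(G)² ≤ P_t(arcFourArm 0 3 n₁ n₃)`;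
* `sepFourAdj_mul_glueExt_le_arc_at` —
  `P_t(sepFourAdj n₁ (64q)) · P_t(G_ext)² · P_{1-t}(G_ext)² ≤ P_t(arcFourArm 0 3 n₁ (512Q - 1))`.

The proofs are those of `sepFour_mul_sepFour_mul_glue_le_at` / `sepFour_mul_glueExt_le_at`
(`NearCriticalFourArmQuasiMult.lean`; `AltFourArmGlue.lean` for the landed alternating event) with
the regions of Lemma 13 adapted: the open events live in the inner/outer supports and the cones
over the sides `0, 1`, the closed ones in the supports and the cones over the sides `3, 4`.

## References

* P. Nolin, Near-critical percolation in two dimensions, *Electron. J. Probab.* 13 (2008), §4.3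
  Prop. 12 and Lemma 13 (arXiv 0711.4948: Prop. 11, Lemma 12) [Nolin2008].
* H. Kesten, Scaling relations for 2D-percolation, *Comm. Math. Phys.* 109 (1987), Lemmas 4–6
  [KestenScalingCMP1987].

## Mathlib / tree

Tree: `sepFourAdj`, `sepArmDuo`, `determinedBy_sepArmDuo`, `isUpperSet_sepArmDuo_true`,
`isLowerSet_sepArmDuo_false`, `fourGlueFramesAdj`, `sepFourAdj_glue_subset_arcFourArm`,
`sepFourAdj_glueExt_subset_arcFourArm` (`SepFourAdj.lean`); `triSitePercolation_locallyMonotone_fkg`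
(`LocallyMonotoneFKG.lean`); `real_inter_preimage_readFrame_at` (`NearCriticalFourArmQuasiMult.lean`);
`image_rot_sepConeSupport_inner/outer_subset` (`ArmSeparationFourArmProofs.lean`); `fourGlue`,
`fourGlueExt`, `determinedBy_fourGlue(Ext)`, `fourGlue(Ext)Finset_subset`, `isUpperSet_fourGlue(Ext)`,
`determinedBy_preimage_readFrame`, `IsUpperSet.preimage_readFrame_true/false`, `rot_apply_formula`,
`triNorm_rot` (`ArmSeparationFourArm.lean`, `ArmSeparationRotate.lean`).
-/

noncomputable section

open MeasureTheory Set
open scoped unitInterval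

namespace Literature.Probability.Percolation

open LatticeModels

set_option maxHeartbeats 1600000 in
set_option maxRecDepth 4096 in
/-- **The gluing inequality for four ADJACENT arms at every `t`, landing in the arc-landed host** (Nolin 2008,
Prop. 12 and Lemma 13 [arXiv 0711.4948: Prop. 11, Lemma 12]):
`P_t(sepAdj(n₁, 64q)) · P_t(sepAdj(512(q+1), n₃)) · P_t(G)² · P_{1-t}(G)² ≤ P_t(arcFourArm 0 3 n₁ n₃)`
(`sepAdj = sepFourAdj`, `G = fourGlue q`). Proof that of `sepFour_mul_sepFour_mul_glue_le_at`
(`NearCriticalFourArmQuasiMult.lean`) with the three regions of Nolin's Lemma 13 adapted to the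
adjacent arrangement (open events and open gluing supported in the cones over the sides `0, 1`,
closed ones in the cones over the sides `3, 4`), and `sepFourAdj_glue_subset_arcFourArm` in the
last step. [cite: Nolin2008, §4.3 Prop. 12 and Lemma 13 (arXiv 0711.4948: Prop. 11, Lemma 12)] -/
theorem sepFourAdj_mul_sepFourAdj_mul_glue_le_arc_at (t : unitInterval) {q n₁ n₃ : ℕ} (hq : 1 ≤ q) (h4 : 4 ≤ n₁)
    (h₁ : n₁ ≤ 64 * q) (h₃ : 512 * (q + 1) ≤ n₃) :
    (triSitePercolation t).real (sepFourAdj n₁ (64 * q)) *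
        (triSitePercolation t).real (sepFourAdj (512 * (q + 1)) n₃) *
        ((triSitePercolation t).real (fourGlue q) ^ 2 * (triSitePercolation (σ t)).real (fourGlue q) ^ 2) ≤
      (triSitePercolation t).real (arcFourArm 0 3 n₁ n₃) := by
  classical
  -- the three pairwise disjoint regions of Nolin's Lemma 13
  set S : Finset (Site 2) := triBall (64 * q) ∪
    (triBall (n₃ + n₃ / 8)).filter (fun v => 512 * ((q : ℤ) + 1) ≤ triNorm v) with hS
  set P : Finset (Site 2) := (triBall (512 * (q + 1))).filter
    (fun v => (64 * q : ℤ) < triNorm v ∧ triNorm v < 512 * ((q : ℤ) + 1) ∧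
      ((0 < v 0 ∧ v 1 < 0 ∧ 0 < v 0 + v 1) ∨ (0 < v 0 ∧ 0 < v 1))) with hP
  set M : Finset (Site 2) := (triBall (512 * (q + 1))).filter
    (fun v => (64 * q : ℤ) < triNorm v ∧ triNorm v < 512 * ((q : ℤ) + 1) ∧
      ((v 0 < 0 ∧ 0 < v 1 ∧ v 0 + v 1 < 0) ∨ (v 0 < 0 ∧ v 1 < 0))) with hM
  have hSP : Disjoint S P := by
    rw [Finset.disjoint_left]; intro v hvS hvP
    simp only [hS, hP, Finset.mem_union, Finset.mem_filter, mem_triBall_iff] at hvS hvP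
    push_cast at hvS hvP; omega
  have hSM : Disjoint S M := by
    rw [Finset.disjoint_left]; intro v hvS hvM
    simp only [hS, hM, Finset.mem_union, Finset.mem_filter, mem_triBall_iff] at hvS hvM
    push_cast at hvS hvM; omega
  have hPM : Disjoint P M := by
    rw [Finset.disjoint_left]; intro v hvP hvM
    simp only [hP, hM, Finset.mem_filter] at hvP hvM
    omega
  have e8 : 64 * q / 8 = 8 * q := by omega
  have E8 : 512 * (q + 1) / 8 = 64 * (q + 1) := by omega
  have hq' : (1 : ℤ) ≤ q := by exact_mod_cast hq
  have h₃' : (512 : ℤ) * (q + 1) ≤ n₃ := by exact_mod_cast h₃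
  -- supports of the arm events: inner scale
  have hIn0 : triRotIsoPow 0 '' sepConeSupport n₁ (64 * q) ⊆ ↑S ∪ ↑P := by
    rintro w ⟨v, hv, rfl⟩
    rw [mem_sepConeSupport, e8] at hv
    simp only [triRotIsoPow_zero_apply, Set.mem_union, Finset.mem_coe, hS, hP, Finset.mem_union,
      Finset.mem_filter, mem_triBall_iff]
    push_cast at hv ⊢; omega
  have hIn3 : triRotIsoPow 3 '' sepConeSupport n₁ (64 * q) ⊆ ↑S ∪ ↑M := by
    rintro w ⟨v, hv, rfl⟩
    rw [mem_sepConeSupport, e8] at hv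
    obtain ⟨-, -, -, -, -, -, r30, r31, -⟩ := rot_apply_formula v
    have hn := triNorm_rot 3 v
    simp only [Set.mem_union, Finset.mem_coe, hS, hM, Finset.mem_union, Finset.mem_filter, mem_triBall_iff,
      r30, r31, hn]
    push_cast at hv ⊢; omega
  have hIn1 : triRotIsoPow 1 '' sepConeSupport n₁ (64 * q) ⊆ ↑S ∪ ↑P := by
    rintro w ⟨v, hv, rfl⟩
    rw [mem_sepConeSupport, e8] at hv
    obtain ⟨-, -, r10, r11, -⟩ := rot_apply_formula v
    have hn := triNorm_rot 1 v
    simp only [Set.mem_union, Finset.mem_coe, hS, hP, Finset.mem_union, Finset.mem_filter, mem_triBall_iff,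
      r10, r11, hn]
    push_cast at hv ⊢; omega
  have hIn4 : triRotIsoPow 4 '' sepConeSupport n₁ (64 * q) ⊆ ↑S ∪ ↑M := by
    rintro w ⟨v, hv, rfl⟩
    rw [mem_sepConeSupport, e8] at hv
    obtain ⟨-, -, -, -, -, -, -, -, r40, r41, -⟩ := rot_apply_formula v
    have hn := triNorm_rot 4 v
    simp only [Set.mem_union, Finset.mem_coe, hS, hM, Finset.mem_union, Finset.mem_filter, mem_triBall_iff,
      r40, r41, hn]
    push_cast at hv ⊢; omega
  -- supports of the arm events: outer scale
  have hOut0 : triRotIsoPow 0 '' sepConeSupport (512 * (q + 1)) n₃ ⊆ ↑S ∪ ↑P := by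
    rintro w ⟨v, hv, rfl⟩
    rw [mem_sepConeSupport, E8] at hv
    simp only [triRotIsoPow_zero_apply, Set.mem_union, Finset.mem_coe, hS, hP, Finset.mem_union,
      Finset.mem_filter, mem_triBall_iff]
    push_cast at hv ⊢; omega
  have hOut3 : triRotIsoPow 3 '' sepConeSupport (512 * (q + 1)) n₃ ⊆ ↑S ∪ ↑M := by
    rintro w ⟨v, hv, rfl⟩
    rw [mem_sepConeSupport, E8] at hv
    obtain ⟨-, -, -, -, -, -, r30, r31, -⟩ := rot_apply_formula v
    have hn := triNorm_rot 3 v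
    simp only [Set.mem_union, Finset.mem_coe, hS, hM, Finset.mem_union, Finset.mem_filter, mem_triBall_iff,
      r30, r31, hn]
    push_cast at hv ⊢; omega
  have hOut1 : triRotIsoPow 1 '' sepConeSupport (512 * (q + 1)) n₃ ⊆ ↑S ∪ ↑P := by
    rintro w ⟨v, hv, rfl⟩
    rw [mem_sepConeSupport, E8] at hv
    obtain ⟨-, -, r10, r11, -⟩ := rot_apply_formula v
    have hn := triNorm_rot 1 v
    simp only [Set.mem_union, Finset.mem_coe, hS, hP, Finset.mem_union, Finset.mem_filter, mem_triBall_iff,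
      r10, r11, hn]
    push_cast at hv ⊢; omega
  have hOut4 : triRotIsoPow 4 '' sepConeSupport (512 * (q + 1)) n₃ ⊆ ↑S ∪ ↑M := by
    rintro w ⟨v, hv, rfl⟩
    rw [mem_sepConeSupport, E8] at hv
    obtain ⟨-, -, -, -, -, -, -, -, r40, r41, -⟩ := rot_apply_formula v
    have hn := triNorm_rot 4 v
    simp only [Set.mem_union, Finset.mem_coe, hS, hM, Finset.mem_union, Finset.mem_filter, mem_triBall_iff,
      r40, r41, hn]
    push_cast at hv ⊢; omega
  -- supports of the gluing events
  have hGF : ∀ v ∈ fourGlueFinset q, 0 < v 0 ∧ v 1 < 0 ∧ 0 < v 0 + v 1 := by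
    intro v hv
    have h := fourGlueFinset_subset hq hv
    exact ⟨by omega, h.2.2.1, h.2.2.2⟩
  have hG0 : triRotIsoPow 0 '' (↑(fourGlueFinset q) : Set (Site 2)) ⊆ ↑P := by
    rintro w ⟨v, hv, rfl⟩
    have h := fourGlueFinset_subset hq (Finset.mem_coe.1 hv)
    have hn : triNorm v = v 0 := triNorm_eq_apply_zero h.2.2.1.le h.2.2.2.le
    simp only [triRotIsoPow_zero_apply, Finset.mem_coe, hP, Finset.mem_filter, mem_triBall_iff, hn]
    push_cast; omega
  have hG3 : triRotIsoPow 3 '' (↑(fourGlueFinset q) : Set (Site 2)) ⊆ ↑M := by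
    rintro w ⟨v, hv, rfl⟩
    have h := fourGlueFinset_subset hq (Finset.mem_coe.1 hv)
    have hn : triNorm (triRotIsoPow 3 v) = v 0 := by
      rw [triNorm_rot]; exact triNorm_eq_apply_zero h.2.2.1.le h.2.2.2.le
    obtain ⟨-, -, -, -, -, -, r30, r31, -⟩ := rot_apply_formula v
    simp only [Finset.mem_coe, hM, Finset.mem_filter, mem_triBall_iff, hn, r30, r31]
    push_cast; omega
  have hG1 : triRotIsoPow 1 '' (↑(fourGlueFinset q) : Set (Site 2)) ⊆ ↑P := by
    rintro w ⟨v, hv, rfl⟩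
    have h := fourGlueFinset_subset hq (Finset.mem_coe.1 hv)
    have hn : triNorm (triRotIsoPow 1 v) = v 0 := by
      rw [triNorm_rot]; exact triNorm_eq_apply_zero h.2.2.1.le h.2.2.2.le
    obtain ⟨-, -, r10, r11, -⟩ := rot_apply_formula v
    simp only [Finset.mem_coe, hP, Finset.mem_filter, mem_triBall_iff, hn, r10, r11]
    push_cast; omega
  have hG4 : triRotIsoPow 4 '' (↑(fourGlueFinset q) : Set (Site 2)) ⊆ ↑M := by
    rintro w ⟨v, hv, rfl⟩
    have h := fourGlueFinset_subset hq (Finset.mem_coe.1 hv)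
    have hn : triNorm (triRotIsoPow 4 v) = v 0 := by
      rw [triNorm_rot]; exact triNorm_eq_apply_zero h.2.2.1.le h.2.2.2.le
    obtain ⟨-, -, -, -, -, -, -, -, r40, r41, -⟩ := rot_apply_formula v
    simp only [Finset.mem_coe, hM, Finset.mem_filter, mem_triBall_iff, hn, r40, r41]
    push_cast; omega
  -- locality of the events
  have h4' : 4 ≤ 512 * (q + 1) := by omega
  have dA₁ := determinedBy_sepArmDuo 0 true h4 h₁
  have dA₂ := determinedBy_sepArmDuo 0 true h4' h₃
  have dC₁ := determinedBy_sepArmDuo 3 false h4 h₁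
  have dC₂ := determinedBy_sepArmDuo 3 false h4' h₃
  have dG := determinedBy_fourGlue q
  -- the events
  set A₁ := sepArmDuo 0 true n₁ (64 * q) with hA₁
  set A₂ := sepArmDuo 0 true (512 * (q + 1)) n₃ with hA₂
  set C₁ := sepArmDuo 3 false n₁ (64 * q) with hC₁
  set C₂ := sepArmDuo 3 false (512 * (q + 1)) n₃ with hC₂
  set G := fourGlue q with hGdef
  -- Nolin's Lemma 13
  have fkg := triSitePercolation_locallyMonotone_fkg t hSP hSM hPM
    (Ap := A₁ ∩ A₂) (Am := C₁ ∩ C₂)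
    (Bp := readFrame 0 true ⁻¹' G ∩ readFrame 1 true ⁻¹' G)
    (Bm := readFrame 3 false ⁻¹' G ∩ readFrame 4 false ⁻¹' G)
    ((isUpperSet_sepArmDuo_true 0 n₁ (64 * q)).inter (isUpperSet_sepArmDuo_true 0 (512 * (q + 1)) n₃))
    ((isLowerSet_sepArmDuo_false 3 n₁ (64 * q)).inter (isLowerSet_sepArmDuo_false 3 (512 * (q + 1)) n₃))
    ((IsUpperSet.preimage_readFrame_true 0 (isUpperSet_fourGlue q)).inter
      (IsUpperSet.preimage_readFrame_true 1 (isUpperSet_fourGlue q)))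
    ((IsUpperSet.preimage_readFrame_false 3 (isUpperSet_fourGlue q)).inter
      (IsUpperSet.preimage_readFrame_false 4 (isUpperSet_fourGlue q)))
    ((dA₁.mono (union_subset hIn0 hIn1)).inter (dA₂.mono (union_subset hOut0 hOut1)))
    ((dC₁.mono (union_subset hIn3 hIn4)).inter (dC₂.mono (union_subset hOut3 hOut4)))
    (((determinedBy_preimage_readFrame 0 true dG).mono hG0).inter
      ((determinedBy_preimage_readFrame 1 true dG).mono hG1))
    (((determinedBy_preimage_readFrame 3 false dG).mono hG3).inter
      ((determinedBy_preimage_readFrame 4 false dG).mono hG4))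
  have hAA : A₁ ∩ A₂ ∩ (C₁ ∩ C₂) = sepFourAdj n₁ (64 * q) ∩ sepFourAdj (512 * (q + 1)) n₃ :=
    Set.inter_inter_inter_comm _ _ _ _
  -- independence of the two well-separated events
  have dS₁ : DeterminedBy (sepFourAdj n₁ (64 * q)) ↑(triBall (72 * q)) :=
    (dA₁.mono (union_subset (image_rot_sepConeSupport_inner_subset 0)
      (image_rot_sepConeSupport_inner_subset (0 + 1)))).inter
    (dC₁.mono (union_subset (image_rot_sepConeSupport_inner_subset 3)
      (image_rot_sepConeSupport_inner_subset (3 + 1))))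
  have dS₂ : DeterminedBy (sepFourAdj (512 * (q + 1)) n₃)
      ↑((triBall (n₃ + n₃ / 8)).filter (fun v => 448 * ((q : ℤ) + 1) ≤ triNorm v)) :=
    (dA₂.mono (union_subset (image_rot_sepConeSupport_outer_subset 0)
      (image_rot_sepConeSupport_outer_subset (0 + 1)))).inter
    (dC₂.mono (union_subset (image_rot_sepConeSupport_outer_subset 3)
      (image_rot_sepConeSupport_outer_subset (3 + 1))))
  have hdisj : Disjoint (triBall (72 * q))
      ((triBall (n₃ + n₃ / 8)).filter (fun v => 448 * ((q : ℤ) + 1) ≤ triNorm v)) := by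
    rw [Finset.disjoint_left]; intro v hv hv'
    simp only [Finset.mem_filter, mem_triBall_iff] at hv hv'
    push_cast at hv hv'; omega
  have hind : (triSitePercolation t).real (sepFourAdj n₁ (64 * q) ∩ sepFourAdj (512 * (q + 1)) n₃) =
      (triSitePercolation t).real (sepFourAdj n₁ (64 * q)) *
        (triSitePercolation t).real (sepFourAdj (512 * (q + 1)) n₃) :=
    sitePercolation_real_inter_of_disjoint t dS₁ dS₂ hdisj
  -- independence of the tubes of different frames
  have hBp : (triSitePercolation t).real (readFrame 0 true ⁻¹' G ∩ readFrame 1 true ⁻¹' G) =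
      (triSitePercolation t).real G * (triSitePercolation t).real G := by
    rw [real_inter_preimage_readFrame_at t (by norm_num) (by norm_num) (by norm_num) true dG hGF]; rfl
  have hBm : (triSitePercolation t).real (readFrame 3 false ⁻¹' G ∩ readFrame 4 false ⁻¹' G) =
      (triSitePercolation (σ t)).real G * (triSitePercolation (σ t)).real G := by
    rw [real_inter_preimage_readFrame_at t (by norm_num) (by norm_num) (by norm_num) false dG hGF]; rfl
  -- the deterministic gluing
  have hsub : A₁ ∩ A₂ ∩ (C₁ ∩ C₂) ∩
      (readFrame 0 true ⁻¹' G ∩ readFrame 1 true ⁻¹' G ∩ (readFrame 3 false ⁻¹' G ∩ readFrame 4 false ⁻¹' G)) ⊆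
      arcFourArm 0 3 n₁ n₃ := by
    rintro ω ⟨⟨⟨hA1, hA2⟩, hC1, hC2⟩, hBp', hBm'⟩
    exact sepFourAdj_glue_subset_arcFourArm hq h4 h₁ h₃ ⟨⟨⟨hA1, hC1⟩, hBp', hBm'⟩, hA2, hC2⟩
  calc (triSitePercolation t).real (sepFourAdj n₁ (64 * q)) *
        (triSitePercolation t).real (sepFourAdj (512 * (q + 1)) n₃) *
        ((triSitePercolation t).real G ^ 2 * (triSitePercolation (σ t)).real G ^ 2)
      = (triSitePercolation t).real (A₁ ∩ A₂ ∩ (C₁ ∩ C₂)) *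
          ((triSitePercolation t).real (readFrame 0 true ⁻¹' G ∩ readFrame 1 true ⁻¹' G) *
            (triSitePercolation t).real (readFrame 3 false ⁻¹' G ∩ readFrame 4 false ⁻¹' G)) := by
        rw [hAA, hind, hBp, hBm]; ring
    _ ≤ _ := fkg
    _ ≤ (triSitePercolation t).real (arcFourArm 0 3 n₁ n₃) := measureReal_mono hsub (measure_ne_top _ _)

set_option maxHeartbeats 1600000 in
set_option maxRecDepth 4096 in
/-- **The extension inequality for four ADJACENT arms at every `t`, landing in the arc-landed host** (Nolin
2008, Prop. 12 (i) [arXiv 0711.4948: Prop. 11]):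
`P_t(sepAdj(n₁, 64q)) · P_t(G_ext)² · P_{1-t}(G_ext)² ≤ P_t(arcFourArm 0 3 n₁ (512(q+1) - 1))`; proof
that of `sepFour_mul_glueExt_le_at` with the adjacent regions, last step
`sepFourAdj_glueExt_subset_arcFourArm`. [cite: Nolin2008, §4.3 Prop. 12 and Lemma 13 (arXiv 0711.4948: Prop. 11, Lemma 12)] -/
theorem sepFourAdj_mul_glueExt_le_arc_at (t : unitInterval) {q n₁ : ℕ} (hq : 1 ≤ q) (h4 : 4 ≤ n₁) (h₁ : n₁ ≤ 64 * q) :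
    (triSitePercolation t).real (sepFourAdj n₁ (64 * q)) *
        ((triSitePercolation t).real (fourGlueExt q) ^ 2 * (triSitePercolation (σ t)).real (fourGlueExt q) ^ 2) ≤
      (triSitePercolation t).real (arcFourArm 0 3 n₁ (512 * (q + 1) - 1)) := by
  classical
  set S : Finset (Site 2) := triBall (64 * q) with hS
  set P : Finset (Site 2) := (triBall (512 * (q + 1))).filter
    (fun v => (64 * q : ℤ) < triNorm v ∧ triNorm v < 512 * ((q : ℤ) + 1) ∧
      ((0 < v 0 ∧ v 1 < 0 ∧ 0 < v 0 + v 1) ∨ (0 < v 0 ∧ 0 < v 1))) with hP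
  set M : Finset (Site 2) := (triBall (512 * (q + 1))).filter
    (fun v => (64 * q : ℤ) < triNorm v ∧ triNorm v < 512 * ((q : ℤ) + 1) ∧
      ((v 0 < 0 ∧ 0 < v 1 ∧ v 0 + v 1 < 0) ∨ (v 0 < 0 ∧ v 1 < 0))) with hM
  have hSP : Disjoint S P := by
    rw [Finset.disjoint_left]; intro v hvS hvP
    simp only [hS, hP, Finset.mem_filter, mem_triBall_iff] at hvS hvP
    push_cast at hvS hvP; omega
  have hSM : Disjoint S M := by
    rw [Finset.disjoint_left]; intro v hvS hvM
    simp only [hS, hM, Finset.mem_filter, mem_triBall_iff] at hvS hvM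
    push_cast at hvS hvM; omega
  have hPM : Disjoint P M := by
    rw [Finset.disjoint_left]; intro v hvP hvM
    simp only [hP, hM, Finset.mem_filter] at hvP hvM
    omega
  have e8 : 64 * q / 8 = 8 * q := by omega
  have hq' : (1 : ℤ) ≤ q := by exact_mod_cast hq
  -- supports of the arm events
  have hIn0 : triRotIsoPow 0 '' sepConeSupport n₁ (64 * q) ⊆ ↑S ∪ ↑P := by
    rintro w ⟨v, hv, rfl⟩
    rw [mem_sepConeSupport, e8] at hv
    simp only [triRotIsoPow_zero_apply, Set.mem_union, Finset.mem_coe, hS, hP, Finset.mem_filter, mem_triBall_iff]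
    push_cast at hv ⊢; omega
  have hIn3 : triRotIsoPow 3 '' sepConeSupport n₁ (64 * q) ⊆ ↑S ∪ ↑M := by
    rintro w ⟨v, hv, rfl⟩
    rw [mem_sepConeSupport, e8] at hv
    obtain ⟨-, -, -, -, -, -, r30, r31, -⟩ := rot_apply_formula v
    have hn := triNorm_rot 3 v
    simp only [Set.mem_union, Finset.mem_coe, hS, hM, Finset.mem_filter, mem_triBall_iff, r30, r31, hn]
    push_cast at hv ⊢; omega
  have hIn1 : triRotIsoPow 1 '' sepConeSupport n₁ (64 * q) ⊆ ↑S ∪ ↑P := by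
    rintro w ⟨v, hv, rfl⟩
    rw [mem_sepConeSupport, e8] at hv
    obtain ⟨-, -, r10, r11, -⟩ := rot_apply_formula v
    have hn := triNorm_rot 1 v
    simp only [Set.mem_union, Finset.mem_coe, hS, hP, Finset.mem_filter, mem_triBall_iff, r10, r11, hn]
    push_cast at hv ⊢; omega
  have hIn4 : triRotIsoPow 4 '' sepConeSupport n₁ (64 * q) ⊆ ↑S ∪ ↑M := by
    rintro w ⟨v, hv, rfl⟩
    rw [mem_sepConeSupport, e8] at hv
    obtain ⟨-, -, -, -, -, -, -, -, r40, r41, -⟩ := rot_apply_formula v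
    have hn := triNorm_rot 4 v
    simp only [Set.mem_union, Finset.mem_coe, hS, hM, Finset.mem_filter, mem_triBall_iff, r40, r41, hn]
    push_cast at hv ⊢; omega
  -- supports of the extension events
  have hGF : ∀ v ∈ fourGlueExtFinset q, 0 < v 0 ∧ v 1 < 0 ∧ 0 < v 0 + v 1 := by
    intro v hv
    have h := fourGlueExtFinset_subset hq hv
    exact ⟨by omega, h.2.2.1, h.2.2.2⟩
  have hG0 : triRotIsoPow 0 '' (↑(fourGlueExtFinset q) : Set (Site 2)) ⊆ ↑P := by
    rintro w ⟨v, hv, rfl⟩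
    have h := fourGlueExtFinset_subset hq (Finset.mem_coe.1 hv)
    have hn : triNorm v = v 0 := triNorm_eq_apply_zero h.2.2.1.le h.2.2.2.le
    simp only [triRotIsoPow_zero_apply, Finset.mem_coe, hP, Finset.mem_filter, mem_triBall_iff, hn]
    push_cast; omega
  have hG3 : triRotIsoPow 3 '' (↑(fourGlueExtFinset q) : Set (Site 2)) ⊆ ↑M := by
    rintro w ⟨v, hv, rfl⟩
    have h := fourGlueExtFinset_subset hq (Finset.mem_coe.1 hv)
    have hn : triNorm (triRotIsoPow 3 v) = v 0 := by
      rw [triNorm_rot]; exact triNorm_eq_apply_zero h.2.2.1.le h.2.2.2.le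
    obtain ⟨-, -, -, -, -, -, r30, r31, -⟩ := rot_apply_formula v
    simp only [Finset.mem_coe, hM, Finset.mem_filter, mem_triBall_iff, hn, r30, r31]
    push_cast; omega
  have hG1 : triRotIsoPow 1 '' (↑(fourGlueExtFinset q) : Set (Site 2)) ⊆ ↑P := by
    rintro w ⟨v, hv, rfl⟩
    have h := fourGlueExtFinset_subset hq (Finset.mem_coe.1 hv)
    have hn : triNorm (triRotIsoPow 1 v) = v 0 := by
      rw [triNorm_rot]; exact triNorm_eq_apply_zero h.2.2.1.le h.2.2.2.le
    obtain ⟨-, -, r10, r11, -⟩ := rot_apply_formula v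
    simp only [Finset.mem_coe, hP, Finset.mem_filter, mem_triBall_iff, hn, r10, r11]
    push_cast; omega
  have hG4 : triRotIsoPow 4 '' (↑(fourGlueExtFinset q) : Set (Site 2)) ⊆ ↑M := by
    rintro w ⟨v, hv, rfl⟩
    have h := fourGlueExtFinset_subset hq (Finset.mem_coe.1 hv)
    have hn : triNorm (triRotIsoPow 4 v) = v 0 := by
      rw [triNorm_rot]; exact triNorm_eq_apply_zero h.2.2.1.le h.2.2.2.le
    obtain ⟨-, -, -, -, -, -, -, -, r40, r41, -⟩ := rot_apply_formula v
    simp only [Finset.mem_coe, hM, Finset.mem_filter, mem_triBall_iff, hn, r40, r41]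
    push_cast; omega
  -- locality
  have dA₁ := determinedBy_sepArmDuo 0 true h4 h₁
  have dC₁ := determinedBy_sepArmDuo 3 false h4 h₁
  have dG := determinedBy_fourGlueExt q
  set A₁ := sepArmDuo 0 true n₁ (64 * q) with hA₁
  set C₁ := sepArmDuo 3 false n₁ (64 * q) with hC₁
  set G := fourGlueExt q with hGdef
  have fkg := triSitePercolation_locallyMonotone_fkg t hSP hSM hPM (Ap := A₁) (Am := C₁)
    (Bp := readFrame 0 true ⁻¹' G ∩ readFrame 1 true ⁻¹' G)
    (Bm := readFrame 3 false ⁻¹' G ∩ readFrame 4 false ⁻¹' G)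
    (isUpperSet_sepArmDuo_true 0 n₁ (64 * q)) (isLowerSet_sepArmDuo_false 3 n₁ (64 * q))
    ((IsUpperSet.preimage_readFrame_true 0 (isUpperSet_fourGlueExt q)).inter
      (IsUpperSet.preimage_readFrame_true 1 (isUpperSet_fourGlueExt q)))
    ((IsUpperSet.preimage_readFrame_false 3 (isUpperSet_fourGlueExt q)).inter
      (IsUpperSet.preimage_readFrame_false 4 (isUpperSet_fourGlueExt q)))
    (dA₁.mono (union_subset hIn0 hIn1)) (dC₁.mono (union_subset hIn3 hIn4))
    (((determinedBy_preimage_readFrame 0 true dG).mono hG0).inter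
      ((determinedBy_preimage_readFrame 1 true dG).mono hG1))
    (((determinedBy_preimage_readFrame 3 false dG).mono hG3).inter
      ((determinedBy_preimage_readFrame 4 false dG).mono hG4))
  have hBp : (triSitePercolation t).real (readFrame 0 true ⁻¹' G ∩ readFrame 1 true ⁻¹' G) =
      (triSitePercolation t).real G * (triSitePercolation t).real G := by
    rw [real_inter_preimage_readFrame_at t (by norm_num) (by norm_num) (by norm_num) true dG hGF]; rfl
  have hBm : (triSitePercolation t).real (readFrame 3 false ⁻¹' G ∩ readFrame 4 false ⁻¹' G) =
      (triSitePercolation (σ t)).real G * (triSitePercolation (σ t)).real G := by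
    rw [real_inter_preimage_readFrame_at t (by norm_num) (by norm_num) (by norm_num) false dG hGF]; rfl
  have hsub : A₁ ∩ C₁ ∩
      (readFrame 0 true ⁻¹' G ∩ readFrame 1 true ⁻¹' G ∩ (readFrame 3 false ⁻¹' G ∩ readFrame 4 false ⁻¹' G)) ⊆
      arcFourArm 0 3 n₁ (512 * (q + 1) - 1) := by
    rintro ω ⟨⟨hA1, hC1⟩, hBp', hBm'⟩
    exact sepFourAdj_glueExt_subset_arcFourArm hq h4 h₁ ⟨⟨hA1, hC1⟩, hBp', hBm'⟩
  calc (triSitePercolation t).real (sepFourAdj n₁ (64 * q)) *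
        ((triSitePercolation t).real G ^ 2 * (triSitePercolation (σ t)).real G ^ 2)
      = (triSitePercolation t).real (A₁ ∩ C₁) *
          ((triSitePercolation t).real (readFrame 0 true ⁻¹' G ∩ readFrame 1 true ⁻¹' G) *
            (triSitePercolation t).real (readFrame 3 false ⁻¹' G ∩ readFrame 4 false ⁻¹' G)) := by
        rw [hBp, hBm]; simp only [sepFourAdj, hA₁, hC₁]; ring
    _ ≤ _ := fkg
    _ ≤ (triSitePercolation t).real (arcFourArm 0 3 n₁ (512 * (q + 1) - 1)) :=
        measureReal_mono hsub (measure_ne_top _ _)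


end Literature.Probability.Percolation
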